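import Literature.NumberTheory.EllipticCurves.NeronComponentIndexTypeI0starProofs
import Literature.NumberTheory.EllipticCurves.NeronComponentIndexTypeIVExact
import Literature.NumberTheory.EllipticCurves.TamagawaSubgroupProofs
import Literature.NumberTheory.EllipticCurves.CongruentNumberCurveMinimalAtTwo
import Literature.NumberTheory.EllipticCurves.BSDAnalyticRankTunnellCMProofs
import Mathlib.NumberTheory.Padics.HeightOneSpectrum
import HarnessLib

/-!
# The Tamagawa numbers of the congruent number curve: `∏_ℓ c_ℓ(E_n) = 2^{2k(n)+2−a(n)}`, PROVED

Topic `Literature/NumberTheory/EllipticCurves`; `Proofs`-style file (THEOREMS ONLY: no definition,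
no named fact, no instance). Cell `b2b-bsdres`, sub-lane `bsd-p2`
(`run/shared/lean/b2b/bsd-rank1-residual/p2/`), literature typer 1, backlog item G-T2 (lead GO
L1-35, 2026-08-22). HONEST FRAMING: a textbook computation (Tate's algorithm for the family
`y² = x³ − n²x`) proved in the kernel from tree/Mathlib theorems; it removes the displayed hypothesis
`htam : tamagawaProduct (congruentNumberCurve n) = …` of the sub-lane's per-pair BSD₂ doors
(`P2/CongruentNumberPairsAtTwo*`, D-CN-5 / D-CN-6, family theorem T-54) and is leg (ii) of the
printed normalisation `TianYuanZhang2017.bsd_iff_cardSha_eq_scriptLSq`; nothing is asserted,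
nothing booked, no mark moved.

## The printed statement

For the congruent number curve `E_n : y² = x³ − n²x`, `n ≥ 1` square-free, with `k(n)` the number
of odd prime factors of `n` and `a(n) = 1` (`n` odd), `0` (`n` even):
`∏_ℓ c_ℓ(E_n) = 2^{2k(n) + 2 − a(n)}`, i.e. `c_p = 4` at every odd `p ∣ n`, `c₂ = 2` (`n` odd) resp.
`c₂ = 4` (`n` even), `c_ℓ = 1` otherwise. Tian–Yuan–Zhang build exactly this power of `2` into
their `𝓛(n)` ("the definition is made so that [BSD] writes as `#Ш(E_n) = 𝓛(n)²`",
[TianYuanZhang2017, §1 (1.1), arXiv p0002 L71–L75]); Tian, *Proc. ICM 2022*, p. 2001, displays the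
same exponent ("the 2-divisibility of `y_n` fully comes from Tamagawa numbers"). Neither source
prints the local computation; it is Tate's algorithm (J. Tate, *Algorithm for determining the type
of a singular fiber in an elliptic pencil*, LNM 476 (1975) §7) as in Silverman, *ATAEC* IV.9.4:
Step 4 (type `III`, `c = 2`), Step 6 (type `I₀*`, `c = 1 + #{roots in k of P(T)}`, here `P(T) =
T³ − (n/p)²T` with three roots, `c = 4`), Step 7 (type `Iₙ*`; `E_{2m}` at `2` is `I₂*` with
`c = 4`), Table 4.1 (PDF pp. 344–347).

## Proof followed (no Néron model, no Kodaira symbol: the index `[E(K) : E₀(K)]` directly)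

In the tree `c_v = [E(K_v) : E₀(K_v)]` is an index (`WeierstrassCurve.localTamagawaNumber`,
`Tamagawa.lean`), computed on any minimal `O_v`-model (`LocalIndex.localTamagawaNumber_eq_index_of_smul_eq_baseChange`,
Silverman *AEC* VII.1.3(b)); `E_n` is its own global minimal model
(`isGloballyMinimal_congruentNumberCurve`). Over a discrete valuation ring `R` with fraction field
`K` we prove, with the elementary tools of `LocalIndexBadPoints.lean` /
`NeronComponentIndexTypeI0starProofs.lean` (bad points are the integral points in `𝔪 × 𝔪`; the
chord through two bad points; bad points of the `I₀*` normal form lie over roots of the cubic and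
two bad points over the same simple root add into `E₀`):
* (A) `2 ∈ Rˣ`, `ϖ` a uniformiser, `m ∈ Rˣ`: `y² = x³ − ϖ²m²x` has index `4` — the points
  `(0,0), (±ϖm, 0)` of order two are bad and pairwise inequivalent (the sum of two is the third),
  and every bad point lies over one of the three SIMPLE roots `0, ±m̄` of `T³ − m̄²T`, hence is
  congruent to the corresponding point of order two: `E(K)/E₀(K) = {𝒪, (0,0), (±ϖm,0)}`
  (`LocalIndex.index_eq_four_of_split_Istar_zero`);
* (B) `2` a uniformiser, `n ∈ Rˣ`: `y² = x³ − n²x` has index `2` — after `x ↦ x + n` the point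
  `T = (0, 0)` is bad and for a bad `P = (x, y)` the chord gives `x(P + T) = 2n²/x`, a unit
  (`v(x) = 1`) or non-integral (`v(x) ≥ 2`), so `P + T ∈ E₀(K)`
  (`LocalIndex.index_eq_two_congruentModel`);
* (C) `2` a uniformiser, `m ∈ Rˣ`: `y² = x³ − (2m)²x` has index `4` — representatives
  `𝒪, (0,0), (±2m,0)`; a bad `P = (x,y)`, `x = 2x₁`, is attached to the root `0` if `2 ∣ x₁`
  (`x(P + (0,0)) = −m²/(x₁/2)`), and otherwise `x₁ ≡ m (2)` (else `y² = 8·unit`), `x₁ − m = 2s₁`,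
  attached to `2m` if `2 ∣ s₁` (`x(P + (2m,0)) = m(s₁ + m)/(s₁/2)`) and to `−2m` if `s₁` is a
  unit (then `s₁ + m = 2w₁`, else `y² = 32·unit`; `x(P + (−2m,0)) = −ms₁/w₁`); in each case the new
  `x`-coordinate is `unit/w`, a unit or non-integral, so the sum is in `E₀(K)`
  (`LocalIndex.index_eq_four_congruentModel_even`);
* (D) at a place `v` of `ℚ`: `p_v` is a uniformiser of `O_v` (transport of `PadicInt.irreducible_p`
  along Mathlib's `adicCompletionIntegers.padicIntEquiv`), integers prime to `p_v` are units;
  `c_v = 1` for `p_v ∤ 2n` (good reduction, `Δ = 64n⁶` a `v`-unit); and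
  `∏ᶠ_v c_v = c_{v₂} · ∏_{p ∣ n odd} 4` (`finprod_eq_prod_of_mulSupport_subset` over the places
  above the primes dividing `2n`, Mathlib's `Rat.HeightOneSpectrum.primesEquiv`).

## Results

* generic (namespace `LocalIndex`): `index_eq_card_of_representatives`, `neg_some_zero`,
  `some_zero_add_some_zero`, `Δ_of_shortA4`, `index_eq_four_of_split_Istar_zero` (A),
  `index_eq_two_of_translated_two_irreducible`, `index_eq_two_congruentModel` (B),
  `sq_ne_pow_odd_mul_of_isUnit`, `hasNonsingularReduction_some_of_eq_unit_div`,
  `addX_zero_of_shortA4`, `addX_twoTorsion_of_shortA4`, `index_eq_four_congruentModel_even` (C);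
* `E_n` (namespace `Literature.NumberTheory.EllipticCurves`):
  `irreducible_natGenerator_adicCompletionIntegers_rat_rat`, `isUnit_natCast_adicCompletionIntegers_of_not_dvd`,
  `localTamagawaNumber_congruentNumberCurve_eq_index`,
  `localTamagawaNumber_congruentNumberCurve_of_dvd_odd` (`c_p = 4`, odd `p ∣ n`),
  `localTamagawaNumber_congruentNumberCurve_two_of_odd` (`c₂ = 2`),
  `localTamagawaNumber_congruentNumberCurve_two_of_even` (`c₂ = 4`),
  `localTamagawaNumber_congruentNumberCurve_of_not_dvd` (`c_v = 1`),
  **`tamagawaProduct_congruentNumberCurve`**: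
  `(congruentNumberCurve n).tamagawaProduct = (if Even n then 4 else 2) * 4 ^ #{odd p ∣ n}`,
  `tamagawaProduct_congruentNumberCurve_eq_two_pow` (`= 2 ^ (2k + 2 − a)`),
  `padicValNat_two_tamagawaProduct_congruentNumberCurve`, `tamagawaProduct_congruentNumberCurve_of_odd`
  (`= 2^{2·#primeFactors + 1}`), `tamagawaProduct_congruentNumberCurve_of_even`
  (`= 2^{2·#(primeFactors ∖ {2}) + 2}`).

## References

* [SilvermanATAEC1994] J. H. Silverman, *Advanced Topics in the Arithmetic of Elliptic Curves*,
  GTM 151, Springer 1994, IV.9.4 Steps 4, 6, 7 and Table 4.1 (PDF pp. 344–347); proof of the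
  algorithm IV.9 (PDF pp. 348–352).
* [Tate1975] J. Tate, *Algorithm for determining the type of a singular fiber in an elliptic
  pencil*, in Modular Functions of One Variable IV, LNM 476 (1975), §7.
* [SilvermanAEC2009] J. H. Silverman, *The Arithmetic of Elliptic Curves*, 2nd ed., GTM 106,
  VII.1 Prop. 1.3(b), VII.2 Prop. 2.1, VII.6 Ex. 7.6.
* [TianYuanZhang2017] Y. Tian, X. Yuan, S.-W. Zhang, *Genus periods, genus points and congruent
  number problem*, Asian J. Math. 21 (2017) 721–774 (arXiv:1411.4728), §1 (1.1).
-/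

noncomputable section

open scoped Classical

open IsLocalRing Literature.NumberTheory.DiophantineGeometry
  Literature.NumberTheory.DiophantineGeometry.TateAlgorithm

namespace Literature.NumberTheory.EllipticCurves

namespace LocalIndex

/-! ### A counting lemma: index from a complete system of pairwise inequivalent representatives -/

/-- If `r : ι → G` hits every coset of `H` and its values are pairwise inequivalent modulo `H`, then
`[G : H] = #ι`. [folklore] -/
private theorem index_eq_card_of_representatives {G : Type*} [AddCommGroup G] (H : AddSubgroup G)
    {ι : Type*} [Fintype ι] (r : ι → G) (hcover : ∀ g : G, ∃ i, g - r i ∈ H)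
    (hsep : ∀ i j, r i - r j ∈ H → i = j) : H.index = Fintype.card ι := by
  rw [AddSubgroup.index, ← Nat.card_eq_fintype_card]
  refine (Nat.card_eq_of_bijective (fun i => (r i : G ⧸ H)) ⟨fun i j hij => ?_, fun q => ?_⟩).symm
  · exact hsep i j ((QuotientAddGroup.eq_iff_sub_mem).mp hij)
  · induction q using QuotientAddGroup.induction_on with
    | H g =>
      obtain ⟨i, hi⟩ := hcover g
      exact ⟨i, ((QuotientAddGroup.eq_iff_sub_mem).mpr hi).symm⟩

/-! ### Two-torsion points `(e, 0)` on `y² = x³ + a₂x² + a₄x` -/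

section TwoTorsion

variable {F : Type*} [Field F] {W : WeierstrassCurve.Affine F}

/-- On a curve with `a₁ = a₃ = 0`, a point `(e, 0)` is its own negative. [folklore] -/
private theorem neg_some_zero (h1 : W.a₁ = 0) (h3 : W.a₃ = 0) {e : F} (h : W.Nonsingular e 0) :
    -WeierstrassCurve.Affine.Point.some e 0 h = .some e 0 h := by
  rw [WeierstrassCurve.Affine.Point.neg_some]
  exact point_some_congr rfl (by simp [WeierstrassCurve.Affine.negY, h1, h3])

/-- **Chord through two points of order two.** On `y² = x³ + a₂x² + a₄x + a₆` (`a₁ = a₃ = 0`), the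
sum of two distinct points `(e₁, 0)`, `(e₂, 0)` is the point `(-a₂ - e₁ - e₂, 0)` (slope `0`).
[folklore] -/
private theorem some_zero_add_some_zero (h1 : W.a₁ = 0) (h3 : W.a₃ = 0) {e₁ e₂ x₃ : F} (hne : e₁ ≠ e₂)
    (h₁ : W.Nonsingular e₁ 0) (h₂ : W.Nonsingular e₂ 0) (h₃ : W.Nonsingular x₃ 0)
    (hx₃ : x₃ = -W.a₂ - e₁ - e₂) :
    WeierstrassCurve.Affine.Point.some e₁ 0 h₁ + .some e₂ 0 h₂ = .some x₃ 0 h₃ := by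
  subst hx₃
  rw [WeierstrassCurve.Affine.Point.add_of_X_ne hne]
  have hs : W.slope e₁ e₂ 0 0 = 0 := by
    rw [WeierstrassCurve.Affine.slope_of_X_ne hne, sub_zero, zero_div]
  refine point_some_congr ?_ ?_
  · rw [hs]; simp [WeierstrassCurve.Affine.addX, h1]
  · rw [hs]
    simp [WeierstrassCurve.Affine.addY, WeierstrassCurve.Affine.negAddY,
      WeierstrassCurve.Affine.addX, WeierstrassCurve.Affine.negY, h1, h3]

end TwoTorsion

/-! ### (A) Odd residue characteristic: `y² = x³ − ϖ²m²x` has `[E(K) : E₀(K)] = 4` -/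

section OddChar

variable {R : Type*} [CommRing R] [IsDomain R] [IsDiscreteValuationRing R]
  {K : Type*} [Field K] [Algebra R K] [IsFractionRing R K]

/-- The discriminant of `y² = x³ + a₄x` is `-64 a₄³`. [folklore] -/
private theorem Δ_of_shortA4 {S : Type*} [CommRing S] (a₄ : S) :
    (⟨0, 0, 0, a₄, 0⟩ : WeierstrassCurve S).Δ = -64 * a₄ ^ 3 := by
  simp only [WeierstrassCurve.Δ, WeierstrassCurve.b₂, WeierstrassCurve.b₄, WeierstrassCurve.b₆,
    WeierstrassCurve.b₈]
  ring

/-- **`c = 4` for the split `I₀*` model `y² = x³ − ϖ²m²x`** over a discrete valuation ring `R` with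
`2 ∈ Rˣ`, `ϖ` a uniformiser and `m ∈ Rˣ`: the three points `(0,0)`, `(±ϖm, 0)` of order two have
singular reduction and are pairwise inequivalent modulo `E₀(K)` (the sum of two of them is the
third), and every point with singular reduction `(ϖx₁, ϖ²y₂)` lies over a root `x̄₁ ∈ {0, ±m̄}` of
`T³ − m̄²T` (`LocalIndex.exists_root_of_not_hasNonsingularReduction`) and is congruent to the
corresponding point of order two (`LocalIndex.hasNonsingularReduction_add_of_same_root`, the
roots being simple as `2m̄² ≠ 0`). This is Tate's case `I₀*` with `#{α ∈ k : P(α) = 0} = 3`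
(Silverman, *ATAEC* IV.9.4 Step 6, Table 4.1: `E(K)/E₀(K) ≅ (ℤ/2ℤ)²`).
[cite: SilvermanATAEC1994, IV.9.4 Step 6 (PDF p. 345)] -/
theorem index_eq_four_of_split_Istar_zero {ϖ m : R} (hϖ : Irreducible ϖ) (hm : IsUnit m)
    (h2 : IsUnit (2 : R)) :
    ((⟨0, 0, 0, -(ϖ ^ 2 * m ^ 2), 0⟩ : WeierstrassCurve R).nonsingularReductionSubgroup
      (integers_valuationRing_valuation R K)).index = 4 := by
  set J : WeierstrassCurve R := ⟨0, 0, 0, -(ϖ ^ 2 * m ^ 2), 0⟩ with hJ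
  set H := J.nonsingularReductionSubgroup (integers_valuationRing_valuation R K) with hH
  have hinj := IsFractionRing.injective R K
  have hϖ0 : ϖ ≠ 0 := hϖ.ne_zero
  have hϖm : ϖ ∈ maximalIdeal R := (IsLocalRing.mem_maximalIdeal _).mpr hϖ.not_isUnit
  have hm0 : m ≠ 0 := hm.ne_zero
  have h20 : (2 : R) ≠ 0 := h2.ne_zero
  -- residues
  have hmres : residue R m ≠ 0 := (isUnit_iff_residue_ne_zero m).mp hm
  have h2res : (2 : ResidueField R) ≠ 0 := by
    have := (isUnit_iff_residue_ne_zero (2 : R)).mp h2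
    rwa [map_ofNat] at this
  have hϖres : residue R ϖ = 0 := (residue_eq_zero_iff _).mpr hϖm
  -- normal-form data of `J`
  have hα : J.a₁ = ϖ * 0 := by simp [hJ]
  have hβ : J.a₂ = ϖ * 0 := by simp [hJ]
  have hγ : J.a₃ = ϖ ^ 2 * 0 := by simp [hJ]
  have hδ : J.a₄ = ϖ ^ 2 * (-(m ^ 2)) := by simp [hJ]
  have hε : J.a₆ = ϖ ^ 3 * 0 := by simp [hJ]
  have h3 : J.a₃ ∈ maximalIdeal R := by simp [hJ]
  have h4 : J.a₄ ∈ maximalIdeal R := by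
    rw [hδ, pow_two, mul_assoc]; exact Ideal.mul_mem_right _ _ hϖm
  -- the discriminant
  have hΔ : J.Δ ≠ 0 := by
    rw [hJ, Δ_of_shortA4]
    have : (-64 : R) = -(2 ^ 6) := by norm_num
    rw [this]
    exact mul_ne_zero (neg_ne_zero.mpr (pow_ne_zero _ h20))
      (pow_ne_zero _ (neg_ne_zero.mpr (mul_ne_zero (pow_ne_zero _ hϖ0) (pow_ne_zero _ hm0))))
  have hΔK : (J.baseChange K).Δ ≠ 0 := by
    rw [WeierstrassCurve.baseChange, WeierstrassCurve.map_Δ]; exact (map_ne_zero_iff _ hinj).mpr hΔ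
  have ha1 : (J.baseChange K).toAffine.a₁ = 0 := by simp [hJ, WeierstrassCurve.baseChange]
  have ha2 : (J.baseChange K).toAffine.a₂ = 0 := by simp [hJ, WeierstrassCurve.baseChange]
  have ha3 : (J.baseChange K).toAffine.a₃ = 0 := by simp [hJ, WeierstrassCurve.baseChange]
  -- the points of order two `T e = (ϖ e, 0)`, `e ∈ {0, m, -m}`
  have hT : ∀ e : R, e * (e ^ 2 - m ^ 2) = 0 →
      (J.baseChange K).toAffine.Nonsingular (algebraMap R K (ϖ * e)) 0 := by
    intro e he
    refine (WeierstrassCurve.Affine.equation_iff_nonsingular_of_Δ_ne_zero hΔK).mp ?_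
    rw [WeierstrassCurve.Affine.equation_iff]
    simp only [hJ, WeierstrassCurve.baseChange, WeierstrassCurve.map_a₁, WeierstrassCurve.map_a₂,
      WeierstrassCurve.map_a₃, WeierstrassCurve.map_a₄, WeierstrassCurve.map_a₆, map_zero, map_neg,
      map_mul, map_pow]
    have : algebraMap R K e * (algebraMap R K e ^ 2 - algebraMap R K m ^ 2) = 0 := by
      have := congrArg (algebraMap R K) he
      simpa using this
    linear_combination (-(algebraMap R K ϖ) ^ 3) * this
  have he0 : (0 : R) * (0 ^ 2 - m ^ 2) = 0 := by ring
  have hep : m * (m ^ 2 - m ^ 2) = 0 := by ring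
  have hen : (-m) * ((-m) ^ 2 - m ^ 2) = 0 := by ring
  set T0 : (J.baseChange K).toAffine.Point := .some _ _ (hT 0 he0) with hT0
  set Tp : (J.baseChange K).toAffine.Point := .some _ _ (hT m hep) with hTp
  set Tn : (J.baseChange K).toAffine.Point := .some _ _ (hT (-m) hen) with hTn
  -- they have singular reduction
  have hbadT : ∀ (e : R) (he : e * (e ^ 2 - m ^ 2) = 0),
      (WeierstrassCurve.Affine.Point.some _ _ (hT e he)) ∉ H := by
    intro e he
    have hns' : (J.baseChange K).toAffine.Nonsingular (algebraMap R K (ϖ * e))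
        (algebraMap R K 0) := by rw [map_zero]; exact hT e he
    have hbad := LocalIndex.not_hasNonsingularReduction_some J h3 h4
      (Ideal.mul_mem_right _ _ hϖm) (Ideal.zero_mem _) hns'
    rw [hH, WeierstrassCurve.mem_nonsingularReductionSubgroup_iff]
    rwa [point_some_congr rfl (map_zero (algebraMap R K)).symm]
  -- the sum of two of the points of order two is the third
  have hsum : ∀ (e₁ e₂ : R) (he₁ : e₁ * (e₁ ^ 2 - m ^ 2) = 0) (he₂ : e₂ * (e₂ ^ 2 - m ^ 2) = 0)
      (he₃ : (-e₁ - e₂) * ((-e₁ - e₂) ^ 2 - m ^ 2) = 0), e₁ ≠ e₂ →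
      WeierstrassCurve.Affine.Point.some _ _ (hT e₁ he₁) + .some _ _ (hT e₂ he₂) =
        .some _ _ (hT (-e₁ - e₂) he₃) := by
    intro e₁ e₂ he₁ he₂ he₃ hne
    have hne' : algebraMap R K (ϖ * e₁) ≠ algebraMap R K (ϖ * e₂) := fun h =>
      hne (mul_left_cancel₀ hϖ0 (hinj h))
    refine some_zero_add_some_zero ha1 ha3 hne' _ _ _ ?_
    rw [ha2]; simp only [map_mul, map_sub, map_neg]; ring
  -- negation fixes the points of order two
  have hneg : ∀ (e : R) (he : e * (e ^ 2 - m ^ 2) = 0),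
      -WeierstrassCurve.Affine.Point.some _ _ (hT e he) = .some _ _ (hT e he) :=
    fun e he => neg_some_zero ha1 ha3 _
  -- every point with singular reduction is congruent to one of the `T e`
  have hcover : ∀ P : (J.baseChange K).toAffine.Point, P ∉ H →
      ∃ (e : R) (he : e * (e ^ 2 - m ^ 2) = 0), (e = 0 ∨ e = m ∨ e = -m) ∧
        P + WeierstrassCurve.Affine.Point.some _ _ (hT e he) ∈ H := by
    intro P hP
    rw [hH, WeierstrassCurve.mem_nonsingularReductionSubgroup_iff] at hP
    obtain ⟨x₁, y₂, h, rfl, hid⟩ :=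
      LocalIndex.exists_root_of_not_hasNonsingularReduction J hϖ hα hβ hγ hδ hε hP
    have hres : residue R x₁ * (residue R x₁ - residue R m) * (residue R x₁ + residue R m) = 0 := by
      have h' := congrArg (residue R) hid
      simp only [map_add, map_mul, map_pow, map_neg, zero_mul, add_zero, hϖres] at h'
      linear_combination h'
    -- the matching root `e`
    have hroot : ∃ e : R, (e = 0 ∨ e = m ∨ e = -m) ∧ residue R x₁ = residue R e := by
      rcases mul_eq_zero.mp hres with h01 | h2'
      · rcases mul_eq_zero.mp h01 with h0 | h1'
        · exact ⟨0, Or.inl rfl, by rw [h0, map_zero]⟩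
        · exact ⟨m, Or.inr (Or.inl rfl), by rwa [sub_eq_zero] at h1'⟩
      · exact ⟨-m, Or.inr (Or.inr rfl), by rwa [map_neg, ← sub_eq_zero, sub_neg_eq_add]⟩
    obtain ⟨e, he3, hxe⟩ := hroot
    have he : e * (e ^ 2 - m ^ 2) = 0 := by
      rcases he3 with rfl | rfl | rfl <;> ring
    refine ⟨e, he, he3, ?_⟩
    -- the root is simple: `3ē² − m̄² ≠ 0`
    have hsimple : 3 * residue R x₁ ^ 2 + 2 * residue R 0 * residue R x₁ + residue R (-(m ^ 2)) ≠ 0 := by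
      rw [hxe, map_zero, map_neg, map_pow]
      rcases he3 with h | h | h <;> rw [h]
      · rw [map_zero]; simpa using pow_ne_zero 2 hmres
      · have : (3 : ResidueField R) * residue R m ^ 2 + 2 * 0 * residue R m + -(residue R m ^ 2) =
            2 * residue R m ^ 2 := by ring
        rw [this]; exact mul_ne_zero h2res (pow_ne_zero 2 hmres)
      · have : (3 : ResidueField R) * residue R (-m) ^ 2 + 2 * 0 * residue R (-m) +
            -(residue R m ^ 2) = 2 * residue R m ^ 2 := by rw [map_neg]; ring
        rw [this]; exact mul_ne_zero h2res (pow_ne_zero 2 hmres)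
    have hns2 : (J.baseChange K).toAffine.Nonsingular (algebraMap R K (ϖ * e))
        (algebraMap R K (ϖ ^ 2 * 0)) := by rw [mul_zero, map_zero]; exact hT e he
    have key := LocalIndex.hasNonsingularReduction_add_of_same_root J hϖ hα hβ hγ hδ hε hxe hsimple
      h hns2
    rw [hH, WeierstrassCurve.mem_nonsingularReductionSubgroup_iff]
    rwa [point_some_congr (x' := algebraMap R K (ϖ * e)) (y' := (0 : K)) rfl
      (by rw [mul_zero, map_zero]) (h' := hT e he)] at key
  -- the points of order two: bad, and closed under addition
  have hT0bad : T0 ∉ H := hbadT 0 he0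
  have hTpbad : Tp ∉ H := hbadT m hep
  have hTnbad : Tn ∉ H := hbadT (-m) hen
  have hmn : m ≠ -m := fun h => by
    have : (2 : R) * m = 0 := by linear_combination h
    exact (mul_ne_zero h20 hm0) this
  have h0p : T0 + Tp = Tn := by
    have := hsum 0 m he0 hep (by ring) hm0.symm
    rw [hT0, hTp, hTn, this]
    exact point_some_congr (by simp) rfl
  have h0n : T0 + Tn = Tp := by
    have := hsum 0 (-m) he0 hen (by ring) (neg_ne_zero.mpr hm0).symm
    rw [hT0, hTp, hTn, this]
    exact point_some_congr (by simp) rfl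
  have hpn : Tp + Tn = T0 := by
    have := hsum m (-m) hep hen (by ring) hmn
    rw [hT0, hTp, hTn, this]
    exact point_some_congr (by simp) rfl
  have hp0 : Tp + T0 = Tn := by rw [add_comm, h0p]
  have hn0 : Tn + T0 = Tp := by rw [add_comm, h0n]
  have hnp : Tn + Tp = T0 := by rw [add_comm, hpn]
  have hT0neg : -T0 = T0 := hneg 0 he0
  have hTpneg : -Tp = Tp := hneg m hep
  have hTnneg : -Tn = Tn := hneg (-m) hen
  -- the system of representatives `0, Tp, Tn, T0`, indexed by `Bool × Bool`
  set r : Bool × Bool → (J.baseChange K).toAffine.Point :=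
    fun i => if i.1 then (if i.2 then T0 else Tp) else (if i.2 then Tn else 0) with hr
  have hcard : Fintype.card (Bool × Bool) = 4 := by simp
  rw [← hcard]
  refine index_eq_card_of_representatives H r (fun P => ?_) (fun i j hij => ?_)
  · -- cover
    by_cases hP : P ∈ H
    · exact ⟨(false, false), by simpa [hr] using hP⟩
    · obtain ⟨e, he, he3, hPe⟩ := hcover P hP
      rcases he3 with h | h | h
      · refine ⟨(true, true), ?_⟩
        simp only [hr, ↓reduceIte, sub_eq_add_neg, hT0neg]
        rw [hT0]; convert hPe; exact h.symm
      · refine ⟨(true, false), ?_⟩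
        simp only [hr, ↓reduceIte, Bool.false_eq_true, sub_eq_add_neg, hTpneg]
        rw [hTp]; convert hPe; exact h.symm
      · refine ⟨(false, true), ?_⟩
        simp only [hr, ↓reduceIte, Bool.false_eq_true, sub_eq_add_neg, hTnneg]
        rw [hTn]; convert hPe; exact h.symm
  · -- pairwise inequivalent
    obtain ⟨i₁, i₂⟩ := i
    obtain ⟨j₁, j₂⟩ := j
    cases i₁ <;> cases i₂ <;> cases j₁ <;> cases j₂ <;>
      simp only [hr, ↓reduceIte, Bool.false_eq_true, sub_eq_add_neg, neg_zero, add_zero, zero_add,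
        hT0neg, hTpneg, hTnneg, h0p, h0n, hpn, hp0, hn0, hnp] at hij ⊢ <;>
      first
      | exact absurd hij hT0bad
      | exact absurd hij hTpbad
      | exact absurd hij hTnbad

end OddChar

/-! ### (B) `2` a uniformiser, `n` a unit: `y² = x³ − n²x` has `[E(K) : E₀(K)] = 2` -/

section TwoOdd

variable {R : Type*} [CommRing R] [IsDomain R] [IsDiscreteValuationRing R]
  {K : Type*} [Field K] [Algebra R K] [IsFractionRing R K]

/-- **`c = 2` for the translated model `y² = x³ + 3n x² + 2n² x`** (`= x(x + n)(x + 2n)`, the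
translate `x ↦ x + n` of `y² = x³ − n²x`) over a discrete valuation ring in which `2` is a
uniformiser, `n ∈ Rˣ`: the point `T = (0, 0)` has singular reduction, and for every point
`P = (x, y)` with singular reduction (`x, y ∈ 𝔪`) the chord through `P` and `T` gives
`x(P + T) = 2n²/x`, which is a unit if `v(x) = 1` and is not integral if `v(x) ≥ 2`; either way
`P + T ∈ E₀(K)`, so `E₀(K)` has index `2` (`LocalIndex.index_eq_two_of_forall_add_mem`). This is
Tate's case `III` at `p = 2` (Silverman, *ATAEC* IV.9.4 Step 4: `c = 2`), made explicit by the
rational point of order two. [cite: SilvermanATAEC1994, IV.9.4 Step 4 (PDF p. 344)] -/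
theorem index_eq_two_of_translated_two_irreducible {n : R} (h2 : Irreducible (2 : R))
    (hn : IsUnit n) :
    ((⟨0, 3 * n, 0, 2 * n ^ 2, 0⟩ : WeierstrassCurve R).nonsingularReductionSubgroup
      (integers_valuationRing_valuation R K)).index = 2 := by
  set J : WeierstrassCurve R := ⟨0, 3 * n, 0, 2 * n ^ 2, 0⟩ with hJ
  set H := J.nonsingularReductionSubgroup (integers_valuationRing_valuation R K) with hH
  have hv := integers_valuationRing_valuation R K
  have hinj := IsFractionRing.injective R K
  have h20 : (2 : R) ≠ 0 := h2.ne_zero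
  have h2m : (2 : R) ∈ maximalIdeal R := (IsLocalRing.mem_maximalIdeal _).mpr h2.not_isUnit
  have hn0 : n ≠ 0 := hn.ne_zero
  have h3 : J.a₃ ∈ maximalIdeal R := by simp [hJ]
  have h4 : J.a₄ ∈ maximalIdeal R := by
    simp only [hJ]; exact Ideal.mul_mem_right _ _ h2m
  have h6 : J.a₆ ∈ maximalIdeal R := by simp [hJ]
  -- discriminant `Δ = 64 n⁶`
  have hΔ : J.Δ ≠ 0 := by
    have : J.Δ = 2 ^ 6 * n ^ 6 := by
      simp only [hJ, WeierstrassCurve.Δ, WeierstrassCurve.b₂, WeierstrassCurve.b₄,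
        WeierstrassCurve.b₆, WeierstrassCurve.b₈]
      ring
    rw [this]; exact mul_ne_zero (pow_ne_zero _ h20) (pow_ne_zero _ hn0)
  have hΔK : (J.baseChange K).Δ ≠ 0 := by
    rw [WeierstrassCurve.baseChange, WeierstrassCurve.map_Δ]; exact (map_ne_zero_iff _ hinj).mpr hΔ
  -- the point `T = (0, 0)` of order two
  have hTns : (J.baseChange K).toAffine.Nonsingular (algebraMap R K 0) (algebraMap R K 0) := by
    refine (WeierstrassCurve.Affine.equation_iff_nonsingular_of_Δ_ne_zero hΔK).mp ?_
    rw [WeierstrassCurve.Affine.equation_iff]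
    simp [hJ, WeierstrassCurve.baseChange]
  set T : (J.baseChange K).toAffine.Point := .some _ _ hTns with hT
  have hTbad : T ∉ H := by
    rw [hH, WeierstrassCurve.mem_nonsingularReductionSubgroup_iff]
    exact LocalIndex.not_hasNonsingularReduction_some J h3 h4 (Ideal.zero_mem _) (Ideal.zero_mem _)
      hTns
  have hTT : T + T = 0 := by
    rw [hT]
    exact WeierstrassCurve.Affine.Point.add_of_Y_eq rfl
      (by simp [WeierstrassCurve.Affine.negY, hJ, WeierstrassCurve.baseChange])
  -- every point with singular reduction is congruent to `T`
  have hadd : ∀ P : (J.baseChange K).toAffine.Point, P ∉ H → P + T ∈ H := by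
    intro P hP
    rw [hH, WeierstrassCurve.mem_nonsingularReductionSubgroup_iff] at hP ⊢
    obtain ⟨a, b, h, rfl, ha, hb⟩ := LocalIndex.exists_eq_some_of_not_hasNonsingularReduction J
      h3 h4 h6 hP
    by_cases ha0 : a = 0
    · -- then `b = 0` and `P = T`
      subst ha0
      have hb0 : b = 0 := by
        have he : J.toAffine.Equation 0 b :=
          (WeierstrassCurve.Affine.map_equation _ hinj _ _).mp h.left
        rw [WeierstrassCurve.Affine.equation_iff] at he
        simp only [hJ] at he
        have : b ^ 2 = 0 := by linear_combination he
        exact pow_eq_zero_iff (n := 2) (by norm_num) |>.mp this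
      subst hb0
      rw [show (WeierstrassCurve.Affine.Point.some _ _ h) = T from rfl, hTT]
      trivial
    · -- the chord through `P` and `T`: `x(P + T) = 2n² / a`
      have hne : algebraMap R K a ≠ algebraMap R K 0 := fun h' => ha0 (hinj h')
      rw [hT, WeierstrassCurve.Affine.Point.add_of_X_ne hne]
      have hA0 : algebraMap R K a ≠ 0 := by rwa [map_zero] at hne
      have heq := h.left
      rw [WeierstrassCurve.Affine.equation_iff] at heq
      simp only [hJ, WeierstrassCurve.baseChange, WeierstrassCurve.map_a₁, WeierstrassCurve.map_a₂,
        WeierstrassCurve.map_a₃, WeierstrassCurve.map_a₄, WeierstrassCurve.map_a₆, map_zero,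
        map_mul, map_pow, map_ofNat, zero_mul, add_zero] at heq
      have hX : (J.baseChange K).toAffine.addX (algebraMap R K a) (algebraMap R K 0)
          ((J.baseChange K).toAffine.slope (algebraMap R K a) (algebraMap R K 0) (algebraMap R K b)
            (algebraMap R K 0)) = algebraMap R K (2 * n ^ 2) / algebraMap R K a := by
        rw [WeierstrassCurve.Affine.slope_of_X_ne hne, WeierstrassCurve.Affine.addX]
        simp only [hJ, WeierstrassCurve.baseChange, WeierstrassCurve.map_a₁, WeierstrassCurve.map_a₂,
          map_zero, map_mul, map_pow, map_ofNat, sub_zero]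
        field_simp
        linear_combination heq
      -- `a = 2 a'`
      obtain ⟨a', rfl⟩ := (mem_maximalIdeal_iff_dvd_of_irreducible h2 a).mp ha
      by_cases ha' : IsUnit a'
      · -- `v(x) = 1`: `x(P + T) = n² / a'` is a unit
        obtain ⟨w, hw⟩ := ha'.exists_left_inv
        have hunit : IsUnit (w * n ^ 2) := (IsUnit.of_mul_eq_one _ hw).mul (hn.pow 2)
        refine LocalIndex.hasNonsingularReduction_some_of_isUnit J h3 h4 h6 hunit _ ?_
        rw [hX, div_eq_iff hA0, ← map_mul]
        congr 1
        linear_combination (-(2 : R) * n ^ 2) * hw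
      · -- `v(x) ≥ 2`: `x(P + T) = n² / (2 a'')` is not integral
        obtain ⟨a'', rfl⟩ := (mem_maximalIdeal_iff_dvd_of_irreducible h2 a').mp
          ((IsLocalRing.mem_maximalIdeal _).mpr ha')
        refine Or.inl ?_
        rw [hX]
        rintro ⟨d, hd⟩
        rw [eq_div_iff hA0, ← map_mul] at hd
        have hd' := hinj hd
        -- `d · (2 · (2 a'')) = 2 n²` gives `2 ∣ n²`, contradicting `n ∈ Rˣ`
        have h2n : (2 : R) ∣ n ^ 2 := ⟨d * a'', mul_left_cancel₀ h20 (by linear_combination -hd')⟩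
        exact h2.not_isUnit (isUnit_of_dvd_unit h2n (hn.pow 2))
  refine LocalIndex.index_eq_two_of_forall_add_mem H hTbad fun P Q hP hQ => ?_
  have := H.add_mem (hadd P hP) (hadd Q hQ)
  rwa [add_add_add_comm, hTT, add_zero] at this

/-- **`c = 2` for `y² = x³ − n²x` when `2` is a uniformiser and `n` a unit** (the congruent number
curve at `p = 2`, `n` odd): translate by `x ↦ x + n` (`LocalIndex.index_nonsingularReductionSubgroup_smul`)
to `index_eq_two_of_translated_two_irreducible`. Tate's case `III`, `c = 2` (Silverman, *ATAEC*
IV.9.4 Step 4). [cite: SilvermanATAEC1994, IV.9.4 Step 4 (PDF p. 344)] -/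
theorem index_eq_two_congruentModel {n : R} (h2 : Irreducible (2 : R)) (hn : IsUnit n) :
    ((⟨0, 0, 0, -(n ^ 2), 0⟩ : WeierstrassCurve R).nonsingularReductionSubgroup
      (integers_valuationRing_valuation R K)).index = 2 := by
  set D : WeierstrassCurve.VariableChange R := ⟨1, n, 0, 0⟩ with hD
  have hDJ : D • (⟨0, 0, 0, -(n ^ 2), 0⟩ : WeierstrassCurve R) = ⟨0, 3 * n, 0, 2 * n ^ 2, 0⟩ := by
    ext <;> simp [hD, WeierstrassCurve.variableChange_a₁, WeierstrassCurve.variableChange_a₂,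
      WeierstrassCurve.variableChange_a₃, WeierstrassCurve.variableChange_a₄,
      WeierstrassCurve.variableChange_a₆] <;> ring
  rw [← LocalIndex.index_nonsingularReductionSubgroup_smul _ D, hDJ]
  exact index_eq_two_of_translated_two_irreducible h2 hn

end TwoOdd

/-! ### (C) `2` a uniformiser, `n = 2m` with `m` a unit: `y² = x³ − 4m²x` has `[E(K) : E₀(K)] = 4` -/

section TwoEven

variable {R : Type*} [CommRing R] [IsDomain R] [IsDiscreteValuationRing R]
  {K : Type*} [Field K] [Algebra R K] [IsFractionRing R K]

/-- `b² = ϖ^{2k+1}·u` is impossible for a uniformiser `ϖ` and a unit `u` (parity of the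
valuation). [folklore] -/
private theorem sq_ne_pow_odd_mul_of_isUnit {ϖ : R} (hϖ : Irreducible ϖ) {u : R} (hu : IsUnit u) (k : ℕ)
    (b : R) : b ^ 2 ≠ ϖ ^ (2 * k + 1) * u := by
  induction k generalizing b with
  | zero =>
    intro h
    rw [mul_zero, zero_add, pow_one] at h
    have hb : ϖ ∣ b := hϖ.prime.dvd_of_dvd_pow (n := 2) ⟨u, h⟩
    obtain ⟨b', rfl⟩ := hb
    have : ϖ * b' ^ 2 = u := mul_left_cancel₀ hϖ.ne_zero (by linear_combination h)
    exact hϖ.not_isUnit (isUnit_of_dvd_unit ⟨b' ^ 2, this.symm⟩ hu)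
  | succ k ih =>
    intro h
    have hb : ϖ ∣ b := hϖ.prime.dvd_of_dvd_pow (n := 2) ⟨ϖ ^ (2 * k + 2) * u, by rw [h]; ring⟩
    obtain ⟨b', rfl⟩ := hb
    refine ih b' (mul_left_cancel₀ (pow_ne_zero 2 hϖ.ne_zero) ?_)
    linear_combination h

/-- A point `(x, y)` of an `R`-model with `a₃, a₄, a₆ ∈ 𝔪` whose `x`-coordinate is `u / w` with
`u ∈ Rˣ`, `w ∈ R ∖ {0}`, has nonsingular reduction: if `w` is a unit then `x` is a unit of `R`
(`LocalIndex.hasNonsingularReduction_some_of_isUnit`), otherwise `x ∉ R` and the point reduces to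
`𝒪`. [folklore] -/
private theorem hasNonsingularReduction_some_of_eq_unit_div (I : WeierstrassCurve R)
    (h3 : I.a₃ ∈ maximalIdeal R) (h4 : I.a₄ ∈ maximalIdeal R) (h6 : I.a₆ ∈ maximalIdeal R)
    {u w : R} (hu : IsUnit u) (hw : w ≠ 0) {x y : K} (h : (I.baseChange K).toAffine.Nonsingular x y)
    (hx : x = algebraMap R K u / algebraMap R K w) : I.HasNonsingularReduction (.some _ _ h) := by
  have hinj := IsFractionRing.injective R K
  have hw' : algebraMap R K w ≠ 0 := (map_ne_zero_iff _ hinj).mpr hw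
  by_cases hwu : IsUnit w
  · obtain ⟨wi, hwi⟩ := hwu.exists_left_inv
    refine LocalIndex.hasNonsingularReduction_some_of_isUnit I h3 h4 h6
      ((IsUnit.of_mul_eq_one _ hwi).mul hu) _ (a := wi * u) ?_
    rw [hx, div_eq_iff hw', ← map_mul]
    congr 1
    linear_combination (-u) * hwi
  · refine Or.inl ?_
    rintro ⟨d, hd⟩
    rw [hx, eq_div_iff hw', ← map_mul] at hd
    exact hwu (isUnit_of_dvd_unit ⟨d, (hinj hd).symm.trans (mul_comm _ _)⟩ hu)

/-- Chord through `(x, y)` and the point `(0, 0)` of order two on `y² = x³ + a₄x`: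
`x(P + T) = a₄ / x`. [folklore] -/
private theorem addX_zero_of_shortA4 {F : Type*} [Field F] {W : WeierstrassCurve.Affine F} (h1 : W.a₁ = 0)
    (h2 : W.a₂ = 0) (h3 : W.a₃ = 0) (h6 : W.a₆ = 0) {x y : F} (hxy : W.Equation x y) (hx : x ≠ 0) :
    W.addX x 0 (W.slope x 0 y 0) = W.a₄ / x := by
  rw [WeierstrassCurve.Affine.equation_iff, h1, h2, h3, h6] at hxy
  rw [WeierstrassCurve.Affine.slope_of_X_ne hx, WeierstrassCurve.Affine.addX, h1, h2]
  field_simp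
  linear_combination x * hxy

/-- Chord through `(x, y)` and a point `(e, 0)` of order two on `y² = x³ + a₄x` with
`e² = −a₄` (so `y² = x(x − e)(x + e)`): `x(P + T) = e(x + e)/(x − e)`. [folklore] -/
private theorem addX_twoTorsion_of_shortA4 {F : Type*} [Field F] {W : WeierstrassCurve.Affine F}
    (h1 : W.a₁ = 0) (h2 : W.a₂ = 0) (h3 : W.a₃ = 0) (h6 : W.a₆ = 0) {x y e : F}
    (hxy : W.Equation x y) (he : e ^ 2 = -W.a₄) (hx : x ≠ e) :
    W.addX x e (W.slope x e y 0) = e * (x + e) / (x - e) := by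
  rw [WeierstrassCurve.Affine.equation_iff, h1, h2, h3, h6] at hxy
  have ha4 : W.a₄ = -e ^ 2 := by rw [he, neg_neg]
  rw [WeierstrassCurve.Affine.slope_of_X_ne hx, WeierstrassCurve.Affine.addX, h1, h2]
  have hxe : x - e ≠ 0 := sub_ne_zero.mpr hx
  field_simp
  rw [ha4] at hxy
  linear_combination hxy

/-- **`c = 4` for `y² = x³ − (2m)²x` when `2` is a uniformiser and `m` a unit** (the congruent
number curve `E_n` at `p = 2` for `n = 2m`, `m` odd). The three points `(0,0)`, `(±2m, 0)` of order
two have singular reduction and are pairwise inequivalent modulo `E₀(K)`; a point `P = (x, y)` with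
singular reduction (`x, y ∈ 𝔪`) other than these satisfies, with `x = 2x₁`:
if `2 ∣ x₁` then `x(P + (0,0)) = −4m²/x = −m²/(x₁/2)`; if `x₁` is a unit then `x₁ ≡ m (mod 2)`
(otherwise `y² = 8·unit`, impossible) and, with `s = x₁ − m = 2s₁`, either `2 ∣ s₁` and
`x(P + (2m,0)) = 2m(x₁ + m)/s = m(2s₂ + m)/s₂` (`s₁ = 2s₂`), or `s₁` is a unit, `x₁ + m = s₁ + m +
s₁` hence `w = s₁ + m = 2w₁` (otherwise `y² = 32·unit`) and `x(P + (−2m,0)) = −2ms/(x₁ + m) =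
−ms₁/w₁`; in each case the new `x`-coordinate is `unit / w`, so the sum has nonsingular reduction
(`hasNonsingularReduction_some_of_eq_unit_div`). Hence `E(K)/E₀(K) = {𝒪, (0,0), (±2m,0)}`, of
order `4`. (For `R = ℤ₂` this is Tate's case `I₂*` with `c = 4`; Silverman, *ATAEC* IV.9.4 Step 7
and Table 4.1.) [cite: SilvermanATAEC1994, IV.9.4 Step 7 (PDF pp. 346–347) and Table 4.1] -/
theorem index_eq_four_congruentModel_even {m : R} (h2 : Irreducible (2 : R)) (hm : IsUnit m) :
    ((⟨0, 0, 0, -((2 * m) ^ 2), 0⟩ : WeierstrassCurve R).nonsingularReductionSubgroup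
      (integers_valuationRing_valuation R K)).index = 4 := by
  set J : WeierstrassCurve R := ⟨0, 0, 0, -((2 * m) ^ 2), 0⟩ with hJ
  set H := J.nonsingularReductionSubgroup (integers_valuationRing_valuation R K) with hH
  have hinj := IsFractionRing.injective R K
  have h20 : (2 : R) ≠ 0 := h2.ne_zero
  have h2m : (2 : R) ∈ maximalIdeal R := (IsLocalRing.mem_maximalIdeal _).mpr h2.not_isUnit
  have hm0 : m ≠ 0 := hm.ne_zero
  have h2res : residue R 2 = 0 := (residue_eq_zero_iff _).mpr h2m
  have hmres : residue R m ≠ 0 := (isUnit_iff_residue_ne_zero m).mp hm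
  have hφ2 : algebraMap R K 2 ≠ 0 := (map_ne_zero_iff _ hinj).mpr h20
  have h3 : J.a₃ ∈ maximalIdeal R := by simp [hJ]
  have h4 : J.a₄ ∈ maximalIdeal R := by
    have : J.a₄ = 2 * (-(2 * m ^ 2)) := by simp only [hJ]; ring
    rw [this]; exact Ideal.mul_mem_right _ _ h2m
  have h6 : J.a₆ ∈ maximalIdeal R := by simp [hJ]
  -- discriminant `Δ = 2¹² m⁶`
  have hΔ : J.Δ ≠ 0 := by
    rw [hJ, Δ_of_shortA4]
    have : (-64 : R) * (-(2 * m) ^ 2) ^ 3 = 2 ^ 12 * m ^ 6 := by ring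
    rw [this]; exact mul_ne_zero (pow_ne_zero _ h20) (pow_ne_zero _ hm0)
  have hΔK : (J.baseChange K).Δ ≠ 0 := by
    rw [WeierstrassCurve.baseChange, WeierstrassCurve.map_Δ]; exact (map_ne_zero_iff _ hinj).mpr hΔ
  have ha1 : (J.baseChange K).toAffine.a₁ = 0 := by simp [hJ, WeierstrassCurve.baseChange]
  have ha2 : (J.baseChange K).toAffine.a₂ = 0 := by simp [hJ, WeierstrassCurve.baseChange]
  have ha3 : (J.baseChange K).toAffine.a₃ = 0 := by simp [hJ, WeierstrassCurve.baseChange]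
  have ha4 : (J.baseChange K).toAffine.a₄ = -(algebraMap R K (2 * m)) ^ 2 := by
    simp [hJ, WeierstrassCurve.baseChange]
  have ha6 : (J.baseChange K).toAffine.a₆ = 0 := by simp [hJ, WeierstrassCurve.baseChange]
  -- the points of order two `T e = (e, 0)`, `e ∈ {0, 2m, -2m}`
  have hT : ∀ e : R, e * (e ^ 2 - (2 * m) ^ 2) = 0 →
      (J.baseChange K).toAffine.Nonsingular (algebraMap R K e) 0 := by
    intro e he
    refine (WeierstrassCurve.Affine.equation_iff_nonsingular_of_Δ_ne_zero hΔK).mp ?_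
    rw [WeierstrassCurve.Affine.equation_iff, ha1, ha2, ha3, ha4, ha6]
    have : algebraMap R K e * (algebraMap R K e ^ 2 - algebraMap R K (2 * m) ^ 2) = 0 := by
      have := congrArg (algebraMap R K) he
      simpa using this
    linear_combination -this
  have he0 : (0 : R) * (0 ^ 2 - (2 * m) ^ 2) = 0 := by ring
  have hep : (2 * m) * ((2 * m) ^ 2 - (2 * m) ^ 2) = 0 := by ring
  have hen : (-(2 * m)) * ((-(2 * m)) ^ 2 - (2 * m) ^ 2) = 0 := by ring
  set T0 : (J.baseChange K).toAffine.Point := .some _ _ (hT 0 he0) with hT0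
  set Tp : (J.baseChange K).toAffine.Point := .some _ _ (hT (2 * m) hep) with hTp
  set Tn : (J.baseChange K).toAffine.Point := .some _ _ (hT (-(2 * m)) hen) with hTn
  -- they have singular reduction
  have hbadT : ∀ (e : R) (he : e * (e ^ 2 - (2 * m) ^ 2) = 0), e ∈ maximalIdeal R →
      (WeierstrassCurve.Affine.Point.some _ _ (hT e he)) ∉ H := by
    intro e he hem
    have hns' : (J.baseChange K).toAffine.Nonsingular (algebraMap R K e) (algebraMap R K 0) := by
      rw [map_zero]; exact hT e he
    have hbad := LocalIndex.not_hasNonsingularReduction_some J h3 h4 hem (Ideal.zero_mem _) hns'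
    rw [hH, WeierstrassCurve.mem_nonsingularReductionSubgroup_iff]
    rwa [point_some_congr rfl (map_zero (algebraMap R K)).symm]
  have h0m : (0 : R) ∈ maximalIdeal R := Ideal.zero_mem _
  have h2mm : 2 * m ∈ maximalIdeal R := Ideal.mul_mem_right _ _ h2m
  have h2mn : -(2 * m) ∈ maximalIdeal R := Submodule.neg_mem _ h2mm
  have hT0bad : T0 ∉ H := hbadT 0 he0 h0m
  have hTpbad : Tp ∉ H := hbadT _ hep h2mm
  have hTnbad : Tn ∉ H := hbadT _ hen h2mn
  -- sums and negatives of the points of order two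
  have hsum : ∀ (e₁ e₂ : R) (he₁ : e₁ * (e₁ ^ 2 - (2 * m) ^ 2) = 0)
      (he₂ : e₂ * (e₂ ^ 2 - (2 * m) ^ 2) = 0) (he₃ : (-e₁ - e₂) * ((-e₁ - e₂) ^ 2 - (2 * m) ^ 2) = 0),
      e₁ ≠ e₂ → WeierstrassCurve.Affine.Point.some _ _ (hT e₁ he₁) + .some _ _ (hT e₂ he₂) =
        .some _ _ (hT (-e₁ - e₂) he₃) := by
    intro e₁ e₂ he₁ he₂ he₃ hne
    have hne' : algebraMap R K e₁ ≠ algebraMap R K e₂ := fun h => hne (hinj h)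
    refine some_zero_add_some_zero ha1 ha3 hne' _ _ _ ?_
    rw [ha2]; simp only [map_sub, map_neg]; ring
  have hneg : ∀ (e : R) (he : e * (e ^ 2 - (2 * m) ^ 2) = 0),
      -WeierstrassCurve.Affine.Point.some _ _ (hT e he) = .some _ _ (hT e he) :=
    fun e he => neg_some_zero ha1 ha3 _
  have hdouble : ∀ (e : R) (he : e * (e ^ 2 - (2 * m) ^ 2) = 0),
      WeierstrassCurve.Affine.Point.some _ _ (hT e he) + .some _ _ (hT e he) = 0 :=
    fun e he => WeierstrassCurve.Affine.Point.add_of_Y_eq rfl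
      (by simp [WeierstrassCurve.Affine.negY, hJ, WeierstrassCurve.baseChange])
  have h4m : (2 * m) ≠ -(2 * m) := fun h => by
    have : (2 : R) * (2 * m) = 0 := by linear_combination h
    exact mul_ne_zero h20 (mul_ne_zero h20 hm0) this
  have h0p : T0 + Tp = Tn := by
    have := hsum 0 (2 * m) he0 hep (by ring) (mul_ne_zero h20 hm0).symm
    rw [hT0, hTp, hTn, this]; exact point_some_congr (by simp) rfl
  have h0n : T0 + Tn = Tp := by
    have := hsum 0 (-(2 * m)) he0 hen (by ring) (neg_ne_zero.mpr (mul_ne_zero h20 hm0)).symm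
    rw [hT0, hTp, hTn, this]; exact point_some_congr (by simp) rfl
  have hpn : Tp + Tn = T0 := by
    have := hsum (2 * m) (-(2 * m)) hep hen (by ring) h4m
    rw [hT0, hTp, hTn, this]; exact point_some_congr (by simp) rfl
  have hp0 : Tp + T0 = Tn := by rw [add_comm, h0p]
  have hn0 : Tn + T0 = Tp := by rw [add_comm, h0n]
  have hnp : Tn + Tp = T0 := by rw [add_comm, hpn]
  have hT0neg : -T0 = T0 := hneg 0 he0
  have hTpneg : -Tp = Tp := hneg _ hep
  have hTnneg : -Tn = Tn := hneg _ hen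
  -- every point with singular reduction is congruent to one of `T0, Tp, Tn`
  have hcover : ∀ P : (J.baseChange K).toAffine.Point, P ∉ H →
      P + T0 ∈ H ∨ P + Tp ∈ H ∨ P + Tn ∈ H := by
    intro P hP
    rw [hH, WeierstrassCurve.mem_nonsingularReductionSubgroup_iff] at hP
    obtain ⟨a, b, h, rfl, ha, hb⟩ :=
      LocalIndex.exists_eq_some_of_not_hasNonsingularReduction J h3 h4 h6 hP
    simp only [hH, WeierstrassCurve.mem_nonsingularReductionSubgroup_iff]
    -- the equation over `R`
    have heqR : b ^ 2 = a ^ 3 - (2 * m) ^ 2 * a := by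
      have he : J.toAffine.Equation a b :=
        (WeierstrassCurve.Affine.map_equation _ hinj _ _).mp h.left
      rw [WeierstrassCurve.Affine.equation_iff] at he
      simp only [hJ] at he
      linear_combination he
    have heqK : (J.baseChange K).toAffine.Equation (algebraMap R K a) (algebraMap R K b) := h.left
    -- `P` is one of the points of order two?
    by_cases hroot : a * (a ^ 2 - (2 * m) ^ 2) = 0
    · have hb0 : b = 0 := by
        have : b ^ 2 = 0 := by rw [heqR]; linear_combination hroot
        exact pow_eq_zero_iff (n := 2) (by norm_num) |>.mp this
      subst hb0
      have hPT : WeierstrassCurve.Affine.Point.some _ _ h = .some _ _ (hT a hroot) :=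
        point_some_congr rfl (map_zero _)
      rcases mul_eq_zero.mp hroot with ha0 | hsq
      · left
        have e0 : WeierstrassCurve.Affine.Point.some _ _ (hT a hroot) = T0 := by
          rw [hT0]; exact point_some_congr (by rw [ha0]) rfl
        rw [hPT, e0, hdouble _ he0]; trivial
      · have hsq' : (a - 2 * m) * (a + 2 * m) = 0 := by linear_combination hsq
        rcases mul_eq_zero.mp hsq' with hp | hn
        · right; left
          have ep : WeierstrassCurve.Affine.Point.some _ _ (hT a hroot) = Tp := by
            rw [hTp]; exact point_some_congr (by rw [sub_eq_zero.mp hp]) rfl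
          rw [hPT, ep, hdouble _ hep]; trivial
        · right; right
          have en : WeierstrassCurve.Affine.Point.some _ _ (hT a hroot) = Tn := by
            rw [hTn]; exact point_some_congr (by rw [eq_neg_of_add_eq_zero_left hn]) rfl
          rw [hPT, en, hdouble _ hen]; trivial
    -- otherwise `a ∉ {0, ±2m}`; write `a = 2 a₁`
    have ha0 : a ≠ 0 := fun h0 => hroot (by rw [h0]; ring)
    have hap : a ≠ 2 * m := fun h0 => hroot (by rw [h0]; ring)
    have han : a ≠ -(2 * m) := fun h0 => hroot (by rw [h0]; ring)
    obtain ⟨a₁, rfl⟩ := (mem_maximalIdeal_iff_dvd_of_irreducible h2 a).mp ha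
    by_cases ha₁ : IsUnit a₁
    · -- `a₁` a unit: `s = a₁ - m`, `t = a₁ + m`, `b² = 8 a₁ s t`
      have hst : b ^ 2 = 2 ^ 3 * (a₁ * ((a₁ - m) * (a₁ + m))) := by linear_combination heqR
      by_cases hs : IsUnit (a₁ - m)
      · -- then `t` is a unit as well and `b² = 8 · unit`: impossible
        exfalso
        have ht : IsUnit (a₁ + m) := by
          rw [isUnit_iff_residue_ne_zero] at hs ⊢
          have : a₁ + m = (a₁ - m) + 2 * m := by ring
          rwa [this, map_add, map_mul, h2res, zero_mul, add_zero]
        exact sq_ne_pow_odd_mul_of_isUnit h2 (ha₁.mul (hs.mul ht)) 1 b (by rw [hst])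
      obtain ⟨s₁, hs₁⟩ := (mem_maximalIdeal_iff_dvd_of_irreducible h2 _).mp
        ((IsLocalRing.mem_maximalIdeal _).mpr hs)
      by_cases hs₁u : IsUnit s₁
      · -- `s₁` a unit: `w = s₁ + m`
        by_cases hw : IsUnit (s₁ + m)
        · -- `b² = 32 · unit`: impossible
          exfalso
          have h32 : b ^ 2 = 2 ^ 5 * (a₁ * (s₁ * (s₁ + m))) := by
            rw [hst]
            have ht : a₁ + m = 2 * (s₁ + m) := by linear_combination hs₁
            rw [hs₁, ht]; ring
          exact sq_ne_pow_odd_mul_of_isUnit h2 (ha₁.mul (hs₁u.mul hw)) 2 b (by rw [h32])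
        · -- `w = 2 w₁`: `P + Tn` has `x = -m s₁ / w₁`
          obtain ⟨w₁, hw₁⟩ := (mem_maximalIdeal_iff_dvd_of_irreducible h2 _).mp
            ((IsLocalRing.mem_maximalIdeal _).mpr hw)
          have hw₁0 : w₁ ≠ 0 := by
            rintro rfl
            apply han
            linear_combination 2 * hs₁ + 4 * hw₁
          right; right
          have hne : algebraMap R K (2 * a₁) ≠ algebraMap R K (-(2 * m)) := fun h0 => han (hinj h0)
          rw [hTn, WeierstrassCurve.Affine.Point.add_of_X_ne hne]
          refine hasNonsingularReduction_some_of_eq_unit_div J h3 h4 h6 ((hm.mul hs₁u).neg) hw₁0 _ ?_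
          rw [addX_twoTorsion_of_shortA4 ha1 ha2 ha3 ha6 heqK (by rw [ha4]; simp) hne]
          have hd1 : algebraMap R K (2 * a₁) - algebraMap R K (-(2 * m)) ≠ 0 := sub_ne_zero.mpr hne
          have hd2 : algebraMap R K w₁ ≠ 0 := (map_ne_zero_iff _ hinj).mpr hw₁0
          rw [div_eq_div_iff hd1 hd2]
          have key : (-(2 * m)) * (2 * a₁ + -(2 * m)) * w₁ = -(m * s₁) * (2 * a₁ - -(2 * m)) := by
            linear_combination (-4 * m * w₁ + 2 * m * s₁) * hs₁ + (4 * m * s₁) * hw₁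
          have := congrArg (algebraMap R K) key
          simpa only [map_mul, map_add, map_neg, map_sub, map_ofNat] using this
      · -- `s₁ = 2 s₂`: `P + Tp` has `x = m (2 s₂ + m) / s₂`
        obtain ⟨s₂, hs₂⟩ := (mem_maximalIdeal_iff_dvd_of_irreducible h2 _).mp
          ((IsLocalRing.mem_maximalIdeal _).mpr hs₁u)
        have hs₂0 : s₂ ≠ 0 := by
          rintro rfl
          apply hap
          linear_combination 2 * hs₁ + 4 * hs₂
        right; left
        have hne : algebraMap R K (2 * a₁) ≠ algebraMap R K (2 * m) := fun h0 => hap (hinj h0)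
        rw [hTp, WeierstrassCurve.Affine.Point.add_of_X_ne hne]
        have hu : IsUnit (m * (2 * s₂ + m)) := by
          refine hm.mul ?_
          rw [isUnit_iff_residue_ne_zero, map_add, map_mul, h2res, zero_mul, zero_add]
          exact hmres
        refine hasNonsingularReduction_some_of_eq_unit_div J h3 h4 h6 hu hs₂0 _ ?_
        rw [addX_twoTorsion_of_shortA4 ha1 ha2 ha3 ha6 heqK (by rw [ha4]; simp) hne]
        have hd1 : algebraMap R K (2 * a₁) - algebraMap R K (2 * m) ≠ 0 := sub_ne_zero.mpr hne
        have hd2 : algebraMap R K s₂ ≠ 0 := (map_ne_zero_iff _ hinj).mpr hs₂0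
        rw [div_eq_div_iff hd1 hd2]
        have key : (2 * m) * (2 * a₁ + 2 * m) * s₂ = m * (2 * s₂ + m) * (2 * a₁ - 2 * m) := by
          linear_combination (-2 * m ^ 2) * hs₁ + (-4 * m ^ 2) * hs₂
        have := congrArg (algebraMap R K) key
        simpa only [map_mul, map_add, map_sub, map_ofNat] using this
    · -- `a₁ = 2 a₂`: `P + T0` has `x = -m² / a₂`
      obtain ⟨a₂, rfl⟩ := (mem_maximalIdeal_iff_dvd_of_irreducible h2 _).mp
        ((IsLocalRing.mem_maximalIdeal _).mpr ha₁)
      have ha₂0 : a₂ ≠ 0 := by rintro rfl; exact ha0 (by ring)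
      left
      have hne : algebraMap R K (2 * (2 * a₂)) ≠ algebraMap R K 0 := fun h0 => ha0 (hinj h0)
      rw [hT0, WeierstrassCurve.Affine.Point.add_of_X_ne hne]
      refine hasNonsingularReduction_some_of_eq_unit_div J h3 h4 h6 ((hm.pow 2).neg) ha₂0 _ ?_
      have hne0 : algebraMap R K (2 * (2 * a₂)) ≠ 0 := by rwa [map_zero] at hne
      simp only [map_zero]
      rw [addX_zero_of_shortA4 ha1 ha2 ha3 ha6 heqK hne0, ha4]
      have hd2 : algebraMap R K a₂ ≠ 0 := (map_ne_zero_iff _ hinj).mpr ha₂0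
      rw [div_eq_div_iff hne0 hd2]
      have key : -(2 * m) ^ 2 * a₂ = -(m ^ 2) * (2 * (2 * a₂)) := by ring
      have := congrArg (algebraMap R K) key
      simpa only [map_mul, map_neg, map_pow, map_ofNat] using this
  -- the system of representatives `0, Tp, Tn, T0`
  set r : Bool × Bool → (J.baseChange K).toAffine.Point :=
    fun i => if i.1 then (if i.2 then T0 else Tp) else (if i.2 then Tn else 0) with hr
  have hcard : Fintype.card (Bool × Bool) = 4 := by simp
  rw [← hcard]
  refine index_eq_card_of_representatives H r (fun P => ?_) (fun i j hij => ?_)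
  · by_cases hP : P ∈ H
    · exact ⟨(false, false), by simpa [hr] using hP⟩
    · rcases hcover P hP with h | h | h
      · exact ⟨(true, true), by simpa only [hr, ↓reduceIte, sub_eq_add_neg, hT0neg] using h⟩
      · exact ⟨(true, false), by
          simpa only [hr, ↓reduceIte, Bool.false_eq_true, sub_eq_add_neg, hTpneg] using h⟩
      · exact ⟨(false, true), by
          simpa only [hr, ↓reduceIte, Bool.false_eq_true, sub_eq_add_neg, hTnneg] using h⟩
  · obtain ⟨i₁, i₂⟩ := i
    obtain ⟨j₁, j₂⟩ := j
    cases i₁ <;> cases i₂ <;> cases j₁ <;> cases j₂ <;>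
      simp only [hr, ↓reduceIte, Bool.false_eq_true, sub_eq_add_neg, neg_zero, add_zero, zero_add,
        hT0neg, hTpneg, hTnneg, h0p, h0n, hpn, hp0, hn0, hnp] at hij ⊢ <;>
      first
      | exact absurd hij hT0bad
      | exact absurd hij hTpbad
      | exact absurd hij hTnbad

end TwoEven

end LocalIndex

/-! ### (D) The congruent number curve over `ℚ`: local Tamagawa numbers place by place -/

section Places

open IsDedekindDomain NumberField Rat.HeightOneSpectrum

variable (v : HeightOneSpectrum (𝓞 ℚ))

/-- The prime `p_v` below `v` is a uniformiser of `O_v` (transport of Mathlib's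
`PadicInt.irreducible_p` along `O_v ≃ ℤ_[p_v]`, `adicCompletionIntegers.padicIntEquiv`).
[folklore] -/
private theorem irreducible_natGenerator_adicCompletionIntegers_rat :
    Irreducible ((natGenerator v : ℕ) : v.adicCompletionIntegers ℚ) := by
  haveI : Fact (Nat.Prime (primesEquiv v : ℕ)) := ⟨(primesEquiv v).2⟩
  set e := (adicCompletionIntegers.padicIntEquiv v).toRingEquiv with he
  have h := PadicInt.irreducible_p (p := (primesEquiv v : ℕ))
  have key : e.symm ((primesEquiv v : ℕ) : ℤ_[(primesEquiv v : ℕ)]) =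
      ((natGenerator v : ℕ) : v.adicCompletionIntegers ℚ) := by
    rw [map_natCast]; rfl
  rw [← key]
  exact h.map e.symm

/-- A natural number prime to `p_v` is a unit of `O_v`. [folklore] -/
private theorem isUnit_natCast_adicCompletionIntegers_of_not_dvd {m : ℕ} (hm : ¬ natGenerator v ∣ m) :
    IsUnit ((m : ℕ) : v.adicCompletionIntegers ℚ) := by
  rw [HeightOneSpectrum.adicCompletionIntegers.isUnit_iff_valued_eq_one]
  have h : Valued.v ((m : ℕ) : v.adicCompletion ℚ) = 1 := by
    have h' := GaloisRepresentations.Rat.valuation_intCast_eq_one v (n := m) (by exact_mod_cast hm)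
    rw [← map_natCast (algebraMap ℚ (v.adicCompletion ℚ)) m,
      GaloisRepresentations.valued_algebraMap_adicCompletion]
    exact_mod_cast h'
  exact h

/-- The `O_v`-model `y² = x³ − n²x` of the congruent number curve base-changes to `E_n / ℚ_v`. [folklore] -/
private theorem baseChange_congruentModel (n : ℕ) :
    (⟨0, 0, 0, -((n : v.adicCompletionIntegers ℚ) ^ 2), 0⟩ :
        WeierstrassCurve (v.adicCompletionIntegers ℚ)).baseChange (v.adicCompletion ℚ) =
      (congruentNumberCurve n).baseChange (v.adicCompletion ℚ) := by
  ext <;> simp [congruentNumberCurve, WeierstrassCurve.baseChange, WeierstrassCurve.map]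

/-- **The local Tamagawa number of `E_n` at `v` is the index `[E(ℚ_v) : E₀(ℚ_v)]` computed on the
equation `y² = x³ − n²x` itself** (it is a global minimal model for square-free `n`,
`isGloballyMinimal_congruentNumberCurve`; Silverman, *AEC* VII.1.3(b), VII.6 Ex. 7.6 through the
tree's `localTamagawaNumber_eq_index_of_smul_eq_baseChange`).
[cite: SilvermanAEC2009, VII.1 Prop. 1.3(b) and VII.6 Ex. 7.6] -/
theorem localTamagawaNumber_congruentNumberCurve_eq_index {n : ℕ} (hsq : Squarefree n) :
    ((congruentNumberCurve n).baseChange (v.adicCompletion ℚ)).localTamagawaNumber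
        (v.adicCompletionIntegers ℚ) =
      ((⟨0, 0, 0, -((n : v.adicCompletionIntegers ℚ) ^ 2), 0⟩ :
          WeierstrassCurve (v.adicCompletionIntegers ℚ)).nonsingularReductionSubgroup
        (integers_valuationRing_valuation (v.adicCompletionIntegers ℚ) (v.adicCompletion ℚ))).index := by
  have hn : n ≠ 0 := hsq.ne_zero
  haveI := isElliptic_congruentNumberCurve hn
  haveI : ((congruentNumberCurve n).baseChange (v.adicCompletion ℚ)).IsElliptic := by
    unfold WeierstrassCurve.baseChange; infer_instance
  haveI : ((⟨0, 0, 0, -((n : v.adicCompletionIntegers ℚ) ^ 2), 0⟩ :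
      WeierstrassCurve (v.adicCompletionIntegers ℚ)).baseChange (v.adicCompletion ℚ)).IsMinimal
        (v.adicCompletionIntegers ℚ) := by
    rw [baseChange_congruentModel]
    exact (isGloballyMinimal_congruentNumberCurve hsq).isMinimal v
  exact LocalIndex.localTamagawaNumber_eq_index_of_smul_eq_baseChange _ _ 1
    (by rw [one_smul, baseChange_congruentModel])

/-- **`c_v(E_n) = 4` at an odd prime dividing the square-free `n`** (type `I₀*` with split
cubic; Silverman, *ATAEC* IV.9.4 Step 6, Table 4.1): the index computed on `y² = x³ − n²x`
over `O_v` by `index_eq_four_of_split_Istar_zero` (`n = p_v · m` with `m` a `v`-unit, `2` a `v`-unit).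
[cite: SilvermanATAEC1994, IV.9.4 Step 6 (PDF p. 345)] -/
theorem localTamagawaNumber_congruentNumberCurve_of_dvd_odd {n : ℕ} (hsq : Squarefree n)
    (hdvd : natGenerator v ∣ n) (hodd : natGenerator v ≠ 2) :
    ((congruentNumberCurve n).baseChange (v.adicCompletion ℚ)).localTamagawaNumber
        (v.adicCompletionIntegers ℚ) = 4 := by
  rw [localTamagawaNumber_congruentNumberCurve_eq_index v hsq]
  obtain ⟨m, hm⟩ := hdvd
  have hp := prime_natGenerator v
  -- `p ∤ m` since `n = p m` is square-free
  have hpm : ¬ natGenerator v ∣ m := by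
    rintro ⟨k, rfl⟩
    have : natGenerator v * natGenerator v ∣ n := ⟨k, by rw [hm]; ring⟩
    exact hp.ne_one (Nat.isUnit_iff.mp (hsq _ this))
  have h2 : ¬ natGenerator v ∣ 2 := fun h => hodd ((Nat.prime_dvd_prime_iff_eq hp Nat.prime_two).mp h)
  have hmodel : ((⟨0, 0, 0, -((n : v.adicCompletionIntegers ℚ) ^ 2), 0⟩ :
      WeierstrassCurve (v.adicCompletionIntegers ℚ))) =
        ⟨0, 0, 0, -(((natGenerator v : ℕ) : v.adicCompletionIntegers ℚ) ^ 2 *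
          ((m : ℕ) : v.adicCompletionIntegers ℚ) ^ 2), 0⟩ := by
    ext <;> simp [hm, mul_pow]
  rw [hmodel]
  exact LocalIndex.index_eq_four_of_split_Istar_zero (irreducible_natGenerator_adicCompletionIntegers_rat v)
    (isUnit_natCast_adicCompletionIntegers_of_not_dvd v hpm)
    (by exact_mod_cast isUnit_natCast_adicCompletionIntegers_of_not_dvd v h2)

/-- **`c₂(E_n) = 2` for odd `n`** (type `III` at `2`; Silverman, *ATAEC* IV.9.4 Step 4), by
`index_eq_two_congruentModel` over `O_v`, `v ∣ 2`.
[cite: SilvermanATAEC1994, IV.9.4 Step 4 (PDF p. 344)] -/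
theorem localTamagawaNumber_congruentNumberCurve_two_of_odd {n : ℕ} (hsq : Squarefree n)
    (hodd : Odd n) (hv : natGenerator v = 2) :
    ((congruentNumberCurve n).baseChange (v.adicCompletion ℚ)).localTamagawaNumber
        (v.adicCompletionIntegers ℚ) = 2 := by
  rw [localTamagawaNumber_congruentNumberCurve_eq_index v hsq]
  have h2 : Irreducible (2 : v.adicCompletionIntegers ℚ) := by
    have := irreducible_natGenerator_adicCompletionIntegers_rat v
    rwa [hv, Nat.cast_ofNat] at this
  have hn2 : ¬ natGenerator v ∣ n := by
    rw [hv]; exact hodd.not_two_dvd_nat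
  exact LocalIndex.index_eq_two_congruentModel h2 (isUnit_natCast_adicCompletionIntegers_of_not_dvd v hn2)

/-- **`c₂(E_n) = 4` for even square-free `n = 2m`** (the case `I₂*`, `c = 4`, of Tate's algorithm
at `2`; Silverman, *ATAEC* IV.9.4 Step 7 and Table 4.1), by `index_eq_four_congruentModel_even`
over `O_v`, `v ∣ 2` (`m` odd is a `v`-unit). [cite: SilvermanATAEC1994, IV.9.4 Step 7 (PDF pp. 346–347)] -/
theorem localTamagawaNumber_congruentNumberCurve_two_of_even {n : ℕ} (hsq : Squarefree n)
    (heven : Even n) (hv : natGenerator v = 2) :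
    ((congruentNumberCurve n).baseChange (v.adicCompletion ℚ)).localTamagawaNumber
        (v.adicCompletionIntegers ℚ) = 4 := by
  rw [localTamagawaNumber_congruentNumberCurve_eq_index v hsq]
  have h2 : Irreducible (2 : v.adicCompletionIntegers ℚ) := by
    have := irreducible_natGenerator_adicCompletionIntegers_rat v
    rwa [hv, Nat.cast_ofNat] at this
  obtain ⟨m, hm⟩ := heven
  have hm2 : n = 2 * m := by omega
  have hmodd : ¬ 2 ∣ m := by
    rintro ⟨k, rfl⟩
    have : 2 * 2 ∣ n := ⟨k, by omega⟩
    exact absurd (Nat.isUnit_iff.mp (hsq 2 this)) (by norm_num)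
  have hmu : IsUnit ((m : ℕ) : v.adicCompletionIntegers ℚ) :=
    isUnit_natCast_adicCompletionIntegers_of_not_dvd v (by rwa [hv])
  have hmodel : ((⟨0, 0, 0, -((n : v.adicCompletionIntegers ℚ) ^ 2), 0⟩ :
      WeierstrassCurve (v.adicCompletionIntegers ℚ))) =
        ⟨0, 0, 0, -((2 * ((m : ℕ) : v.adicCompletionIntegers ℚ)) ^ 2), 0⟩ := by
    ext <;> simp [hm2]
  rw [hmodel]
  exact LocalIndex.index_eq_four_congruentModel_even h2 hmu

/-- **`c_v(E_n) = 1` at the places not dividing `2n`** (good reduction: `Δ = 64 n⁶` is a `v`-unit;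
Silverman, *AEC* VII.2, remark after Prop. 2.1: `E₀(K) = E(K)` for good reduction).
[cite: SilvermanAEC2009, VII.2 (remark after Prop. 2.1) with VII.5 Prop. 5.1(a)] -/
theorem localTamagawaNumber_congruentNumberCurve_of_not_dvd {n : ℕ}
    (h : ¬ natGenerator v ∣ 2 * n) :
    ((congruentNumberCurve n).baseChange (v.adicCompletion ℚ)).localTamagawaNumber
        (v.adicCompletionIntegers ℚ) = 1 := by
  refine (congruentNumberCurve n).localTamagawaNumber_eq_one_of_hasGoodReductionAt_holds v ?_
  obtain ⟨h₁, h₂, h₃, h₄, h₆⟩ := valuation_congruentNumberCurve_a_le_one v n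
  refine WeierstrassCurve.hasGoodReductionAt_of_valuation_le_one_of_valuation_Δ_eq_one v _
    h₁ h₂ h₃ h₄ h₆ ?_
  have hp := prime_natGenerator v
  have h2 : ¬ (natGenerator v : ℤ) ∣ (64 : ℤ) := by
    intro hd
    have hd' : natGenerator v ∣ 2 ^ 6 := by exact_mod_cast hd
    exact h (dvd_mul_of_dvd_left (hp.dvd_of_dvd_pow hd') n)
  have hn' : ¬ (natGenerator v : ℤ) ∣ (n : ℤ) := by
    intro hd
    exact h (dvd_mul_of_dvd_right (by exact_mod_cast hd) 2)
  rw [congruentNumberCurve_Δ, Valuation.map_mul, Valuation.map_pow]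
  have e64 : v.valuation ℚ (64 : ℚ) = 1 := by
    exact_mod_cast GaloisRepresentations.Rat.valuation_intCast_eq_one v h2
  have en : v.valuation ℚ (n : ℚ) = 1 := by
    exact_mod_cast GaloisRepresentations.Rat.valuation_intCast_eq_one v hn'
  rw [e64, en, one_pow, one_mul]

/-! ### The Tamagawa product of `E_n` -/

/-- **The Tamagawa product of the congruent number curve** `E_n : y² = x³ − n²x`, `n` square-free:
`∏_ℓ c_ℓ(E_n) = c₂ · 4^{k}`, `k` the number of odd prime factors of `n`, `c₂ = 2` for odd `n` and
`c₂ = 4` for even `n` — i.e. `∏ c_ℓ = 2^{2k(n) + 2 − a(n)}` in the notation of Tian–Yuan–Zhang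
(`k(n)` = number of odd prime factors, `a(n) = 1` for odd `n`, `0` for even `n`), the value built
into their normalisation of `𝓛(n)` [TianYuanZhang2017, §1 (1.1)] and asserted for these curves in
Tian, *Proc. ICM 2022*, p. 2001 ("the 2-divisibility of `y_n` fully comes from Tamagawa
numbers"). PROVED here from Tate's algorithm made explicit: `c_p = 4` at the odd `p ∣ n` (type
`I₀*`, split cubic), `c₂ = 2` (`n` odd, type `III`) resp. `4` (`n` even), `c_ℓ = 1` elsewhere.
[cite: SilvermanATAEC1994, IV.9.4 Steps 4, 6, 7 and Table 4.1 (PDF pp. 344–347)] -/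
theorem tamagawaProduct_congruentNumberCurve {n : ℕ} (hsq : Squarefree n) :
    (congruentNumberCurve n).tamagawaProduct =
      (if Even n then 4 else 2) * 4 ^ (n.primeFactors.filter Odd).card := by
  have hn : n ≠ 0 := hsq.ne_zero
  set c : HeightOneSpectrum (𝓞 ℚ) → ℕ := fun v =>
    ((congruentNumberCurve n).baseChange (v.adicCompletion ℚ)).localTamagawaNumber
      (v.adicCompletionIntegers ℚ) with hc
  have htam : (congruentNumberCurve n).tamagawaProduct = ∏ᶠ v, c v := rfl
  -- places from primes
  set pl : Nat.Primes → HeightOneSpectrum (𝓞 ℚ) := fun q => (primesEquiv (R := 𝓞 ℚ)).symm q with hpl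
  have hgen : ∀ q : Nat.Primes, natGenerator (pl q) = q := fun q =>
    congrArg Subtype.val ((primesEquiv (R := 𝓞 ℚ)).apply_symm_apply q)
  have hpl_of_gen : ∀ (v : HeightOneSpectrum (𝓞 ℚ)) (q : Nat.Primes), natGenerator v = q → v = pl q := by
    intro v q h
    show v = (primesEquiv (R := 𝓞 ℚ)).symm q
    rw [Equiv.eq_symm_apply]
    exact Subtype.ext h
  have hpl_inj : Function.Injective pl := (primesEquiv (R := 𝓞 ℚ)).symm.injective
  -- the odd primes dividing `n`, as places, and the place over `2`
  set T : Finset ℕ := n.primeFactors.filter Odd with hT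
  have hTmem : ∀ {p : ℕ}, p ∈ T ↔ p.Prime ∧ p ∣ n ∧ Odd p := by
    intro p
    rw [hT, Finset.mem_filter, Nat.mem_primeFactors]
    exact ⟨fun ⟨⟨h1, h2, _⟩, h3⟩ => ⟨h1, h2, h3⟩, fun ⟨h1, h2, h3⟩ => ⟨⟨h1, h2, hn⟩, h3⟩⟩
  set f : T → HeightOneSpectrum (𝓞 ℚ) := fun p => pl ⟨p.1, (hTmem.mp p.2).1⟩ with hf
  have hf_inj : Function.Injective f := by
    intro p q h
    have := hpl_inj h
    exact Subtype.ext (by simpa using congrArg Subtype.val this)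
  set v₂ : HeightOneSpectrum (𝓞 ℚ) := pl ⟨2, Nat.prime_two⟩ with hv₂
  have hv₂gen : natGenerator v₂ = 2 := hgen ⟨2, Nat.prime_two⟩
  set S : Finset (HeightOneSpectrum (𝓞 ℚ)) := insert v₂ (T.attach.image f) with hS
  have hv₂S : v₂ ∉ T.attach.image f := by
    rw [Finset.mem_image]
    rintro ⟨p, -, hp⟩
    have h1 : natGenerator (f p) = p.1 := hgen ⟨p.1, (hTmem.mp p.2).1⟩
    rw [hp, hv₂gen] at h1
    have hodd : Odd (p : ℕ) := (hTmem.mp p.2).2.2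
    rw [← h1] at hodd
    exact (Nat.not_even_iff_odd.mpr hodd) even_two
  -- the support of `c` is contained in `S`
  have hsupp : Function.mulSupport c ⊆ (S : Set (HeightOneSpectrum (𝓞 ℚ))) := by
    intro v hv
    rw [Function.mem_mulSupport] at hv
    rw [Finset.mem_coe]
    by_contra hvS
    apply hv
    apply localTamagawaNumber_congruentNumberCurve_of_not_dvd
    intro hdvd
    apply hvS
    have hp := prime_natGenerator v
    rw [hS, Finset.mem_insert]
    by_cases h2 : natGenerator v = 2
    · exact Or.inl (hpl_of_gen v ⟨2, Nat.prime_two⟩ h2)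
    · right
      have hpn : natGenerator v ∣ n := by
        rcases (Nat.Prime.dvd_mul hp).mp hdvd with h | h
        · exact absurd ((Nat.prime_dvd_prime_iff_eq hp Nat.prime_two).mp h) h2
        · exact h
      have hmemT : natGenerator v ∈ T := hTmem.mpr ⟨hp, hpn, hp.odd_of_ne_two h2⟩
      rw [Finset.mem_image]
      refine ⟨⟨natGenerator v, hmemT⟩, Finset.mem_attach _ _, ?_⟩
      exact (hpl_of_gen v ⟨natGenerator v, hp⟩ rfl).symm
  rw [htam, finprod_eq_prod_of_mulSupport_subset c hsupp, hS, Finset.prod_insert hv₂S]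
  -- the place over `2`
  have hc2 : c v₂ = if Even n then 4 else 2 := by
    split_ifs with he
    · exact localTamagawaNumber_congruentNumberCurve_two_of_even v₂ hsq he hv₂gen
    · exact localTamagawaNumber_congruentNumberCurve_two_of_odd v₂ hsq (Nat.not_even_iff_odd.mp he) hv₂gen
  -- the odd places dividing `n`
  have hrest : ∏ v ∈ T.attach.image f, c v = 4 ^ T.card := by
    rw [Finset.prod_image fun p _ q _ h => hf_inj h]
    rw [Finset.prod_congr rfl fun p _ => ?_, Finset.prod_const, Finset.card_attach]
    have h1 : natGenerator (f p) = p.1 := hgen ⟨p.1, (hTmem.mp p.2).1⟩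
    have hodd : Odd (p : ℕ) := (hTmem.mp p.2).2.2
    refine localTamagawaNumber_congruentNumberCurve_of_dvd_odd (f p) hsq ?_ ?_
    · rw [h1]; exact (hTmem.mp p.2).2.1
    · rw [h1]; rintro h2; rw [h2] at hodd; exact (Nat.not_even_iff_odd.mpr hodd) even_two
  rw [hc2, hrest]

/-- The same as a power of `2`: `∏_ℓ c_ℓ(E_n) = 2^{2k + 2 − a}` with `k` the number of odd prime
factors of `n` and `a = 1` if `n` is odd, `a = 0` if `n` is even (Tian–Yuan–Zhang's `2^{2k(n)+2−a(n)}`).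
[cite: SilvermanATAEC1994, IV.9.4 Steps 4, 6, 7 and Table 4.1 (PDF pp. 344–347)] -/
theorem tamagawaProduct_congruentNumberCurve_eq_two_pow {n : ℕ} (hsq : Squarefree n) :
    (congruentNumberCurve n).tamagawaProduct =
      2 ^ (2 * (n.primeFactors.filter Odd).card + 2 - (if Even n then 0 else 1)) := by
  rw [tamagawaProduct_congruentNumberCurve hsq]
  have h4 : (4 : ℕ) = 2 ^ 2 := by norm_num
  split_ifs with he
  · rw [Nat.sub_zero, pow_add, pow_mul, ← h4]; ring
  · rw [show 2 * (n.primeFactors.filter Odd).card + 2 - 1 = 2 * (n.primeFactors.filter Odd).card + 1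
      by omega, pow_succ, pow_mul, ← h4]; ring

/-- The `2`-adic valuation: `ord₂ ∏_ℓ c_ℓ(E_n) = 2k + 2 − a` (Tian–Yuan–Zhang's exponent).
[cite: SilvermanATAEC1994, IV.9.4 Steps 4, 6, 7 and Table 4.1 (PDF pp. 344–347)] -/
theorem padicValNat_two_tamagawaProduct_congruentNumberCurve {n : ℕ} (hsq : Squarefree n) :
    padicValNat 2 (congruentNumberCurve n).tamagawaProduct =
      2 * (n.primeFactors.filter Odd).card + 2 - (if Even n then 0 else 1) := by
  rw [tamagawaProduct_congruentNumberCurve_eq_two_pow hsq, padicValNat.prime_pow]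

/-- For odd square-free `n` with `k` prime factors: `∏_ℓ c_ℓ(E_n) = 2^{2k+1}` (`c₂ = 2`, `c_p = 4`).
[cite: SilvermanATAEC1994, IV.9.4 Steps 4 and 6, Table 4.1 (PDF pp. 344–345)] -/
theorem tamagawaProduct_congruentNumberCurve_of_odd {n : ℕ} (hsq : Squarefree n) (hodd : Odd n) :
    (congruentNumberCurve n).tamagawaProduct = 2 ^ (2 * n.primeFactors.card + 1) := by
  rw [tamagawaProduct_congruentNumberCurve_eq_two_pow hsq, if_neg (Nat.not_even_iff_odd.mpr hodd)]
  have hT : n.primeFactors.filter Odd = n.primeFactors := by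
    refine Finset.filter_true_of_mem fun p hp => ?_
    have hp' := Nat.mem_primeFactors.mp hp
    refine hp'.1.odd_of_ne_two ?_
    rintro rfl
    exact hodd.not_two_dvd_nat hp'.2.1
  rw [hT, show 2 * n.primeFactors.card + 2 - 1 = 2 * n.primeFactors.card + 1 by omega]

/-- For even square-free `n` with `k` odd prime factors: `∏_ℓ c_ℓ(E_n) = 2^{2k+2}` (`c₂ = 4`, `c_p = 4`).
[cite: SilvermanATAEC1994, IV.9.4 Steps 6 and 7, Table 4.1 (PDF pp. 345–347)] -/
theorem tamagawaProduct_congruentNumberCurve_of_even {n : ℕ} (hsq : Squarefree n) (heven : Even n) :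
    (congruentNumberCurve n).tamagawaProduct = 2 ^ (2 * (n.primeFactors.erase 2).card + 2) := by
  rw [tamagawaProduct_congruentNumberCurve_eq_two_pow hsq, if_pos heven]
  have hT : n.primeFactors.filter Odd = n.primeFactors.erase 2 := by
    ext p
    rw [Finset.mem_filter, Finset.mem_erase, Nat.mem_primeFactors]
    constructor
    · rintro ⟨hp, hodd⟩
      refine ⟨?_, hp⟩
      rintro rfl
      exact (Nat.not_even_iff_odd.mpr hodd) even_two
    · rintro ⟨h2, hp⟩
      exact ⟨hp, hp.1.odd_of_ne_two h2⟩
  rw [hT]; congr 1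

end Places

end Literature.NumberTheory.EllipticCurves

end
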